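import Literature.Probability.NegativeDependence.AlmostExchangeableRayleigh
import HarnessLib

/-!
# Almost exchangeable measures: h-NLC ⟺ `a`, `b`, `a + b` LC and (ii) (Borcea–Brändén–Liggett, Proposition 6.3)

J. Borcea, P. Brändén, T. M. Liggett, *Negative dependence and the geometry of polynomials*, J. Amer. Math. Soc.
22 (2009) 521–567 (arXiv:0707.2340, held `paper:arxiv-0707.2340`), §6. Verbatim:

> **Proposition 6.3.** Let `μ ∈ 𝔓_{n+1}` be such that its generating polynomial `g = g_μ` is symmetric in its first
> `n` variables, so that `g(z_1,…,z_{n+1}) = z_{n+1} Σ_{k=0}^n a_k e_k(z_1,…,z_n) + Σ_{k=0}^n b_k e_k(z_1,…,z_n)`. Then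
> `μ` is h-NLC if and only if (i) `{a_k}`, `{b_k}`, and `{a_k + b_k}` are LC, and (ii) `a_k b_{k+1} ≥ a_{k+1} b_k` for
> all `0 ≤ k ≤ n-1`.
> *Proof.* Let `S, T ⊂ [n]`. The NLC condition applied to each of the three pairs `(S,T)`, `(S, T ∪ {n+1})`, and
> `(S ∪ {n+1}, T ∪ {n+1})` gives respectively `b_{|S|} b_{|T|} ≥ b_{|S∪T|} b_{|S∩T|}`, `b_{|S|} a_{|T|} ≥ a_{|S∪T|}
> b_{|S∩T|}`, `a_{|S|} a_{|T|} ≥ a_{|S∪T|} a_{|S∩T|}`. Therefore, setting `ℓ = |S|`, `k = |T|`, `m = |S ∩ T|`, we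
> see that NLC is equivalent to (6.2) `b_ℓ b_k ≥ b_{k+ℓ-m} b_m`, `b_ℓ a_k ≥ a_{k+ℓ-m} b_m`, `a_ℓ a_k ≥ a_{k+ℓ-m} a_m`
> for `m ≤ k, ℓ ≤ n` and `k + ℓ ≤ n + m`. If `S ⊆ [n]` has cardinality `n - j`, the measure obtained by projecting `μ`
> onto `2^{S ∪ {n+1}}` is of the same form as `μ` with coefficients `a_k(j) = Σ_{i=0}^j C(j,i) a_{k+i}` and
> `b_k(j) = Σ_{i=0}^j C(j,i) b_{k+i}`, `0 ≤ k ≤ n - j`, while the one obtained by projecting `μ` onto `2^S` is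
> exchangeable with coefficients `a_k(j) + b_k(j)` […]. For the converse, assume that (i) and (ii) hold. Note that
> for each `j`, `{a_k(j)}` is a convolution of two LC sequences, and hence is LC by [Kar], and the same holds for the
> sequences `b_k(j)` and `a_k(j) + b_k(j)`. […] it follows from (6.1) that `a_k(j) b_{k+1}(j) ≥ a_{k+1}(j) b_k(j)`.
> We need to check that `a_k(j) b_ℓ(j) ≥ a_{k+ℓ-m}(j) b_m(j)` for `m ≤ k, ℓ`, and in doing so, can assume that the
> right-hand side is not zero. By Lemma 6.1, it follows that `a_i(j) b_i(j) > 0` for `m ≤ i ≤ k+ℓ-m`. To conclude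
> the proof, write `a_k(j)/a_{k+ℓ-m}(j) ≥ a_m(j)/a_ℓ(j) ≥ b_m(j)/b_ℓ(j)`. □

## Transposition

As in `AlmostExchangeableRayleigh.lean`: `Option τ` (`|τ| = n`, `z_{n+1}` = `none`), `almostExch a b`, LC =
`IsLogConcaveSeq`, h-NLC = `IsHNLC` (`RayleighLogSubmodular.lean`: every `projectOn R μ` satisfies `IsNLC`).
The binomial profiles `a(j)` are `binomShift j a` (`binomShift_succ`: `a(j+1)_k = a(j)_k + a(j)_{k+1}`, so LC is
kept by the tree's `IsLogConcaveSeq.add_mul_succ` instead of the convolution theorem, and (ii) is kept by the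
three-term expansion with the `TP₂` property `tp2_of_lc`); a projection of `almostExch a b` is `almostExchOn R A B`
(the same form on the ground set `R`; `projectOn_almostExch_of_mem`, `projectOn_almostExch_of_not_mem`), and such a
weight is NLC as soon as `A`, `B` are LC and the mixed inequality `A_{k+ℓ-m} B_m ≤ B_ℓ A_k` holds
(`isNLC_almostExchOn`; the mixed inequality is `mixed_of_lc`, by the printed ratio argument).

## Contents

* §1 `binomShift`, `binomShift_zero/_succ/_add`, `sum_powerset_card_add`, `isLogConcaveSeq_binomShift`,
  `condII_binomShift`.
* §2 `almostExchOn`, `mixed_of_lc`, `isNLC_almostExchOn`.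
* §3 `projectOn_almostExch_of_mem`, `projectOn_almostExch_of_not_mem`.
* §4 **`isHNLC_almostExch`** (Prop. 6.3 "if"), **`BorceaBrandenLiggett_prop_6_3_onlyIf`**,
  **`BorceaBrandenLiggett_prop_6_3`**.

## References

* [BorceaBrandenLiggett2007] J. Borcea, P. Brändén, T. M. Liggett, Negative dependence and the geometry of
  polynomials, J. Amer. Math. Soc. 22 (2009); arXiv:0707.2340 — §6 Prop. 6.3 and its proof, Lemma 6.1.
* [Karlin1968] S. Karlin, Total positivity — Ch. 8 §1 (LC sequences).
* [Pemantle2000] R. Pemantle, Towards a theory of negative dependence — Def. 2.4 (h-NLC).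
-/

noncomputable section

open Finset
open Literature.Probability.Distributions

namespace Literature.Probability.NegativeDependence

/-! ## §1 The binomial profiles `a(j)_k = Σ_i C(j,i) a_{k+i}` -/

section Binom

/-- **`a_k(j) = Σ_{i=0}^j C(j,i) a_{k+i}`** — the profiles of the projections. [cite: BorceaBrandenLiggett2007, §6
proof of Prop. 6.3] -/
def binomShift (j : ℕ) (c : ℕ → ℝ) (k : ℕ) : ℝ := ∑ i ∈ range (j + 1), ((j.choose i : ℕ) : ℝ) * c (k + i)

/-- Unfolding `binomShift`. [cite: BorceaBrandenLiggett2007, §6 proof of Prop. 6.3] -/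
theorem binomShift_apply (j : ℕ) (c : ℕ → ℝ) (k : ℕ) :
    binomShift j c k = ∑ i ∈ range (j + 1), ((j.choose i : ℕ) : ℝ) * c (k + i) := rfl

/-- `a(0) = a`. [cite: BorceaBrandenLiggett2007, §6 proof of Prop. 6.3] -/
theorem binomShift_zero (c : ℕ → ℝ) : binomShift 0 c = c := by
  funext k
  rw [binomShift_apply, Finset.sum_range_one, Nat.choose_zero_right, Nat.cast_one, one_mul, Nat.add_zero]

/-- **Pascal's rule for the profiles**: `a(j+1)_k = a(j)_k + a(j)_{k+1}`. [cite: BorceaBrandenLiggett2007, §6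
proof of Prop. 6.3] -/
theorem binomShift_succ (j : ℕ) (c : ℕ → ℝ) :
    binomShift (j + 1) c = fun k => binomShift j c k + 1 * binomShift j c (k + 1) := by
  funext k
  rw [one_mul, binomShift_apply, binomShift_apply, binomShift_apply, Finset.sum_range_succ' _ (j + 1)]
  simp only [Nat.choose_succ_succ', Nat.cast_add, add_mul, Finset.sum_add_distrib, Nat.choose_zero_right,
    Nat.cast_one, one_mul, Nat.add_zero]
  have h1 : ∑ i ∈ range (j + 1), ((j.choose (i + 1) : ℕ) : ℝ) * c (k + (i + 1)) =
      (∑ i ∈ range (j + 1), ((j.choose i : ℕ) : ℝ) * c (k + i)) - c k := by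
    rw [eq_sub_iff_add_eq]
    have h2 : ∑ i ∈ range (j + 1 + 1), ((j.choose i : ℕ) : ℝ) * c (k + i) =
        ∑ i ∈ range (j + 1), ((j.choose i : ℕ) : ℝ) * c (k + i) := by
      rw [Finset.sum_range_succ, Nat.choose_succ_self, Nat.cast_zero, zero_mul, add_zero]
    rw [← h2, Finset.sum_range_succ' _ (j + 1), Nat.choose_zero_right, Nat.cast_one, one_mul]
    simp
  have h3 : ∑ i ∈ range (j + 1), ((j.choose i : ℕ) : ℝ) * c (k + (i + 1)) =
      ∑ i ∈ range (j + 1), ((j.choose i : ℕ) : ℝ) * c (k + 1 + i) :=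
    Finset.sum_congr rfl fun i _ => by rw [Nat.add_right_comm, ← Nat.add_assoc]
  rw [h1, h3]
  ring

/-- The profiles are additive in the sequence. [cite: BorceaBrandenLiggett2007, §6 proof of Prop. 6.3
("exchangeable with coefficients `a_k(j) + b_k(j)`")] -/
theorem binomShift_add (j : ℕ) (a b : ℕ → ℝ) :
    binomShift j (fun k => a k + b k) = fun k => binomShift j a k + binomShift j b k := by
  funext k
  rw [binomShift_apply, binomShift_apply, binomShift_apply, ← Finset.sum_add_distrib]
  exact Finset.sum_congr rfl fun i _ => by ring

/-- Nonnegativity. [cite: BorceaBrandenLiggett2007, §6 proof of Prop. 6.3] -/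
theorem binomShift_nonneg {c : ℕ → ℝ} (hc : ∀ k, 0 ≤ c k) (j k : ℕ) : 0 ≤ binomShift j c k :=
  Finset.sum_nonneg fun _ _ => mul_nonneg (Nat.cast_nonneg _) (hc _)

/-- **Summing a profile over the subsets of a `j`-set**: `Σ_{W ⊆ Q} c(k + |W|) = Σ_i C(j,i) c(k+i)`.
[cite: BorceaBrandenLiggett2007, §6 proof of Prop. 6.3 (the projected coefficients)] -/
theorem sum_powerset_card_add {α : Type*} (Q : Finset α) (c : ℕ → ℝ) (k : ℕ) :
    (∑ W ∈ Q.powerset, c (k + W.card)) = binomShift Q.card c k := by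
  rw [Finset.powerset_card_disjiUnion, Finset.sum_disjiUnion, binomShift_apply]
  refine Finset.sum_congr rfl fun i _ => ?_
  rw [Finset.sum_congr rfl fun W hW => by rw [(Finset.mem_powersetCard.1 hW).2], Finset.sum_const,
    Finset.card_powersetCard, nsmul_eq_mul]

/-- **LC is kept by the profiles** (`a(j+1) = a(j) + a(j)(·+1)`; BBL: "a convolution of two LC sequences, and
hence is LC by [Kar]"). [cite: BorceaBrandenLiggett2007, §6 proof of Prop. 6.3; Karlin1968, Ch. 8 §1] -/
theorem isLogConcaveSeq_binomShift {c : ℕ → ℝ} (hc : IsLogConcaveSeq c) (j : ℕ) : IsLogConcaveSeq (binomShift j c) := by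
  induction j with
  | zero => rw [binomShift_zero]; exact hc
  | succ j ih => rw [binomShift_succ]; exact IsLogConcaveSeq.add_mul_succ ih zero_le_one

/-- **(ii) is kept by the profiles**: `a(j)_k b(j)_{k+1} ≥ a(j)_{k+1} b(j)_k` (BBL: "it follows from (6.1)"; here
`(a_k+a_{k+1})(b_{k+1}+b_{k+2}) - (a_{k+1}+a_{k+2})(b_k+b_{k+1}) = [k] + [k+1] + [a_k b_{k+2} - a_{k+2} b_k]` with
the `TP₂` property `tp2_of_lc`). [cite: BorceaBrandenLiggett2007, §6 proof of Prop. 6.3 (display (6.3))] -/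
theorem condII_binomShift {a b : ℕ → ℝ} (ha : ∀ k, 0 ≤ a k) (hb : ∀ k, 0 ≤ b k)
    (hab : IsLogConcaveSeq fun k => a k + b k) (hii : ∀ k, a (k + 1) * b k ≤ a k * b (k + 1)) (j k : ℕ) :
    binomShift j a (k + 1) * binomShift j b k ≤ binomShift j a k * binomShift j b (k + 1) := by
  induction j generalizing k with
  | zero => rw [binomShift_zero, binomShift_zero]; exact hii k
  | succ j ih =>
    have hq : ∀ k, 0 ≤ binomShift j a k := binomShift_nonneg ha j
    have hr : ∀ k, 0 ≤ binomShift j b k := binomShift_nonneg hb j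
    have hqr : IsLogConcaveSeq fun k => binomShift j a k + binomShift j b k := by
      rw [← binomShift_add]; exact isLogConcaveSeq_binomShift hab j
    have h3 := tp2_of_lc hq hr hqr ih (show k < k + 2 by omega)
    have h1 := ih k
    have h2 := ih (k + 1)
    simp only [binomShift_succ, one_mul]
    nlinarith [h1, h2, h3]

end Binom

/-! ## §2 Weights of almost exchangeable form on a ground set `R`, and their NLC -/

section Form

variable {τ : Type*} [Fintype τ] [DecidableEq τ]

/-- **The almost exchangeable form on the ground set `R ⊆ τ ⊔ {∗}`**: `T ↦ A(|T ∖ ∗|)` if `∗ ∈ T ⊆ R`,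
`B(|T|)` if `∗ ∉ T ⊆ R`, `0` if `T ⊄ R` ("of the same form as `μ`"). [cite: BorceaBrandenLiggett2007, §6 proof of
Prop. 6.3] -/
def almostExchOn (R : Finset (Option τ)) (A B : ℕ → ℝ) : Finset (Option τ) → ℝ := fun T =>
  if T ⊆ R then (if none ∈ T then A T.eraseNone.card else B T.eraseNone.card) else 0

omit [Fintype τ] in
/-- Unfolding `almostExchOn`. [cite: BorceaBrandenLiggett2007, §6 proof of Prop. 6.3] -/
theorem almostExchOn_apply (R : Finset (Option τ)) (A B : ℕ → ℝ) (T : Finset (Option τ)) :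
    almostExchOn R A B T = if T ⊆ R then (if none ∈ T then A T.eraseNone.card else B T.eraseNone.card) else 0 := rfl

/-- **The mixed inequality `a_{k+ℓ-m} b_m ≤ b_ℓ a_k`** (`m ≤ k, ℓ`) from `a`, `a+b` LC and (ii), by the printed
ratio argument `a_k/a_{k+ℓ-m} ≥ a_m/a_ℓ ≥ b_m/b_ℓ` and Lemma 6.1. [cite: BorceaBrandenLiggett2007, §6 proof of
Prop. 6.3 (last paragraph)] -/
theorem mixed_of_lc {a b : ℕ → ℝ} (ha : IsLogConcaveSeq a) (hb : ∀ k, 0 ≤ b k)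
    (hab : IsLogConcaveSeq fun k => a k + b k) (hii : ∀ k, a (k + 1) * b k ≤ a k * b (k + 1))
    {m k l : ℕ} (hmk : m ≤ k) (hml : m ≤ l) : a (k + l - m) * b m ≤ b l * a k := by
  rcases (mul_nonneg (ha.1 (k + l - m)) (hb m)).eq_or_lt with h0 | hpos
  · rw [← h0]; exact mul_nonneg (hb l) (ha.1 k)
  have hbm : 0 < b m := by
    rcases (hb m).eq_or_lt with h' | h'
    · rw [← h', mul_zero] at hpos; exact absurd hpos (lt_irrefl 0)
    · exact h'
  have haK : 0 < a (k + l - m) := by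
    rcases (ha.1 (k + l - m)).eq_or_lt with h' | h'
    · rw [← h', zero_mul] at hpos; exact absurd hpos (lt_irrefl 0)
    · exact h'
  rcases Nat.eq_or_lt_of_le (show m ≤ k + l - m by omega) with heq | hlt
  · -- `k = l = m`
    rw [show k + l - m = m by omega, show k = m by omega, show l = m by omega, mul_comm]
  -- Lemma 6.1: `a_r, b_r > 0` on `[m, k+l-m]`
  have hal : 0 < a l := BorceaBrandenLiggett_lemma_6_1_left ha.1 hb hab hii hlt hbm haK hml (by omega)
  have ham : 0 < a m := BorceaBrandenLiggett_lemma_6_1_left ha.1 hb hab hii hlt hbm haK le_rfl (by omega)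
  -- `a_m a_{k+l-m} ≤ a_k a_l` (LC of `a`) and `a_l b_m ≤ a_m b_l` (TP₂)
  have h1 : a m * a (k + l - m) ≤ a k * a l := ha.2 hmk (by omega) (by omega)
  have h2 : a l * b m ≤ a m * b l := by
    rcases hml.lt_or_eq with hml' | rfl
    · exact tp2_of_lc ha.1 hb hab hii hml'
    · rw [mul_comm]
  have h3 : a (k + l - m) * b m * (a m * a l) ≤ b l * a k * (a m * a l) := by
    calc a (k + l - m) * b m * (a m * a l) = (a m * a (k + l - m)) * (a l * b m) := by ring
      _ ≤ (a k * a l) * (a m * b l) := mul_le_mul h1 h2 (mul_nonneg (ha.1 _) (hb _)) (mul_nonneg (ha.1 _) (ha.1 _))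
      _ = b l * a k * (a m * a l) := by ring
  exact le_of_mul_le_mul_right h3 (mul_pos ham hal)

omit [Fintype τ] in
/-- **NLC of a weight of almost exchangeable form** from LC of `A`, `B` and the mixed inequality (the three
families (6.2): `b_ℓ b_k ≥ b_{k+ℓ-m} b_m`, `b_ℓ a_k ≥ a_{k+ℓ-m} b_m`, `a_ℓ a_k ≥ a_{k+ℓ-m} a_m`).
[cite: BorceaBrandenLiggett2007, §6 proof of Prop. 6.3 ("NLC is equivalent to (6.2)")] -/
theorem isNLC_almostExchOn {R : Finset (Option τ)} {A B : ℕ → ℝ} (hA : IsLogConcaveSeq A) (hB : IsLogConcaveSeq B)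
    (hmix : ∀ m k l : ℕ, m ≤ k → m ≤ l → A (k + l - m) * B m ≤ B l * A k) : IsNLC (almostExchOn R A B) := by
  have h0 : ∀ T, 0 ≤ almostExchOn R A B T := fun T => by
    rw [almostExchOn_apply]; split_ifs; exacts [hA.1 _, hB.1 _, le_rfl]
  intro T₁ T₂
  by_cases h₁ : T₁ ⊆ R
  · by_cases h₂ : T₂ ⊆ R
    · have hU : T₁ ∪ T₂ ⊆ R := Finset.union_subset h₁ h₂
      have hI : T₁ ∩ T₂ ⊆ R := Finset.inter_subset_left.trans h₁
      have hcard : (T₁ ∪ T₂).eraseNone.card + (T₁ ∩ T₂).eraseNone.card = T₁.eraseNone.card + T₂.eraseNone.card := by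
        rw [Finset.eraseNone_union, Finset.eraseNone_inter, Finset.card_union_add_card_inter]
      have hIle : (T₁ ∩ T₂).eraseNone.card ≤ T₁.eraseNone.card := by
        rw [Finset.eraseNone_inter]; exact Finset.card_le_card Finset.inter_subset_left
      have hIle' : (T₁ ∩ T₂).eraseNone.card ≤ T₂.eraseNone.card := by
        rw [Finset.eraseNone_inter]; exact Finset.card_le_card Finset.inter_subset_right
      have hUge : T₁.eraseNone.card ≤ (T₁ ∪ T₂).eraseNone.card := by
        rw [Finset.eraseNone_union]; exact Finset.card_le_card Finset.subset_union_left
      rw [almostExchOn_apply, almostExchOn_apply, almostExchOn_apply, almostExchOn_apply, if_pos hU, if_pos hI,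
        if_pos h₁, if_pos h₂]
      by_cases hn₁ : none ∈ T₁
      · by_cases hn₂ : none ∈ T₂
        · rw [if_pos (Finset.mem_union_left _ hn₁), if_pos (Finset.mem_inter.2 ⟨hn₁, hn₂⟩), if_pos hn₁, if_pos hn₂,
            mul_comm]
          exact hA.2 hIle hUge (by omega)
        · rw [if_pos (Finset.mem_union_left _ hn₁), if_neg (fun h => hn₂ (Finset.mem_inter.1 h).2), if_pos hn₁,
            if_neg hn₂]
          have := hmix (T₁ ∩ T₂).eraseNone.card T₁.eraseNone.card T₂.eraseNone.card hIle hIle'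
          rw [show T₁.eraseNone.card + T₂.eraseNone.card - (T₁ ∩ T₂).eraseNone.card = (T₁ ∪ T₂).eraseNone.card by
            omega] at this
          linarith [this, mul_comm (B T₂.eraseNone.card) (A T₁.eraseNone.card)]
      · by_cases hn₂ : none ∈ T₂
        · rw [if_pos (Finset.mem_union_right _ hn₂), if_neg (fun h => hn₁ (Finset.mem_inter.1 h).1), if_neg hn₁,
            if_pos hn₂]
          have := hmix (T₁ ∩ T₂).eraseNone.card T₂.eraseNone.card T₁.eraseNone.card hIle' hIle
          rw [show T₂.eraseNone.card + T₁.eraseNone.card - (T₁ ∩ T₂).eraseNone.card = (T₁ ∪ T₂).eraseNone.card by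
            omega] at this
          linarith [this]
        · rw [if_neg (by rw [Finset.mem_union, not_or]; exact ⟨hn₁, hn₂⟩),
            if_neg (fun h => hn₁ (Finset.mem_inter.1 h).1), if_neg hn₁, if_neg hn₂, mul_comm]
          exact hB.2 hIle hUge (by omega)
    · rw [almostExchOn_apply, if_neg (fun h => h₂ (Finset.subset_union_right.trans h)), zero_mul]
      exact mul_nonneg (h0 _) (h0 _)
  · rw [almostExchOn_apply, if_neg (fun h => h₁ (Finset.subset_union_left.trans h)), zero_mul]
    exact mul_nonneg (h0 _) (h0 _)

end Form

/-! ## §3 The projections of `almostExch a b` -/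

section Projections

variable {τ : Type*} [Fintype τ] [DecidableEq τ]

/-- **Projection onto `2^{S ∪ {n+1}}`** ("of the same form as `μ` with coefficients `a_k(j)`, `b_k(j)`",
`j = n - |S|`). [cite: BorceaBrandenLiggett2007, §6 proof of Prop. 6.3] -/
theorem projectOn_almostExch_of_mem (a b : ℕ → ℝ) {R : Finset (Option τ)} (hR : none ∈ R) :
    projectOn R (almostExch a b) = almostExchOn R (binomShift Rᶜ.card a) (binomShift Rᶜ.card b) := by
  funext T
  by_cases hT : T ⊆ R
  · rw [projectOn_apply, sum_ite_inter_eq R T hT, almostExchOn_apply, if_pos hT]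
    have hW : ∀ W ∈ Rᶜ.powerset, none ∉ W ∧ Disjoint T W := fun W hW => by
      rw [Finset.mem_powerset] at hW
      exact ⟨fun h => Finset.mem_compl.1 (hW h) hR, Finset.disjoint_left.2 fun x hx hxW => Finset.mem_compl.1 (hW hxW) (hT hx)⟩
    have key : ∀ W ∈ Rᶜ.powerset, almostExch a b (T ∪ W) =
        if none ∈ T then a (T.eraseNone.card + W.card) else b (T.eraseNone.card + W.card) := by
      intro W hW'
      obtain ⟨hnW, hdisj⟩ := hW W hW'
      have hcard : (T ∪ W).eraseNone.card = T.eraseNone.card + W.card := by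
        rw [Finset.eraseNone_union, Finset.card_union_of_disjoint (Finset.disjoint_left.2 fun x hx hx' =>
          Finset.disjoint_left.1 hdisj (Finset.mem_eraseNone.1 hx) (Finset.mem_eraseNone.1 hx')),
          Finset.card_eraseNone_of_not_mem hnW]
      rw [almostExch_apply, hcard]
      by_cases hn : none ∈ T
      · rw [if_pos (Finset.mem_union_left _ hn), if_pos hn]
      · rw [if_neg (by rw [Finset.mem_union, not_or]; exact ⟨hn, hnW⟩), if_neg hn]
    rw [Finset.sum_congr rfl key]
    by_cases hn : none ∈ T
    · simp only [if_pos hn]; exact sum_powerset_card_add _ _ _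
    · simp only [if_neg hn]; exact sum_powerset_card_add _ _ _
  · rw [projectOn_eq_zero_of_not_subset _ hT, almostExchOn_apply, if_neg hT]

/-- **Projection onto `2^S` (`n+1 ∉ S`)**: "exchangeable with coefficients `a_k(j) + b_k(j)`", `j = n - |S|`
(the `A`-profile is immaterial since `∗ ∉ S`). [cite: BorceaBrandenLiggett2007, §6 proof of Prop. 6.3] -/
theorem projectOn_almostExch_of_not_mem (a b : ℕ → ℝ) {R : Finset (Option τ)} (hR : none ∉ R) (A : ℕ → ℝ) :
    projectOn R (almostExch a b) =
      almostExchOn R A (binomShift (Rᶜ.erase none).card fun k => a k + b k) := by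
  funext T
  by_cases hT : T ⊆ R
  · have hnT : none ∉ T := fun h => hR (hT h)
    rw [projectOn_apply, sum_ite_inter_eq R T hT, almostExchOn_apply, if_pos hT, if_neg hnT]
    set Q : Finset (Option τ) := Rᶜ.erase none with hQ
    have hRc : Rᶜ = insert none Q := (Finset.insert_erase (Finset.mem_compl.2 hR)).symm
    have hnQ : none ∉ Q := Finset.notMem_erase none _
    rw [hRc, Finset.sum_powerset_insert hnQ]
    have hW : ∀ W ∈ Q.powerset, none ∉ W ∧ Disjoint T W := fun W hW => by
      rw [Finset.mem_powerset] at hW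
      refine ⟨fun h => hnQ (hW h), Finset.disjoint_left.2 fun x hx hxW => ?_⟩
      exact Finset.mem_compl.1 (Finset.mem_of_mem_erase (hW hxW)) (hT hx)
    have hcard : ∀ W ∈ Q.powerset, (T ∪ W).eraseNone.card = T.eraseNone.card + W.card := fun W hW' => by
      obtain ⟨hnW, hdisj⟩ := hW W hW'
      rw [Finset.eraseNone_union, Finset.card_union_of_disjoint (Finset.disjoint_left.2 fun x hx hx' =>
        Finset.disjoint_left.1 hdisj (Finset.mem_eraseNone.1 hx) (Finset.mem_eraseNone.1 hx')),
        Finset.card_eraseNone_of_not_mem hnW]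
    have key1 : ∀ W ∈ Q.powerset, almostExch a b (T ∪ W) = b (T.eraseNone.card + W.card) := fun W hW' => by
      obtain ⟨hnW, _⟩ := hW W hW'
      rw [almostExch_apply, if_neg (by rw [Finset.mem_union, not_or]; exact ⟨hnT, hnW⟩), hcard W hW']
    have key2 : ∀ W ∈ Q.powerset, almostExch a b (T ∪ insert none W) = a (T.eraseNone.card + W.card) :=
      fun W hW' => by
        rw [Finset.union_insert, almostExch_apply, if_pos (Finset.mem_insert_self _ _), eraseNone_insert_none,
          hcard W hW']
    rw [Finset.sum_congr rfl key1, Finset.sum_congr rfl key2, sum_powerset_card_add, sum_powerset_card_add,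
      binomShift_add]
    dsimp only
    rw [add_comm]
  · rw [projectOn_eq_zero_of_not_subset _ hT, almostExchOn_apply, if_neg hT]

end Projections

/-! ## §4 Proposition 6.3 -/

section Prop63

variable {τ : Type*} [Fintype τ] [DecidableEq τ]

/-- **Borcea–Brändén–Liggett, Prop. 6.3 ("if")**: if `a`, `b`, `a + b` are LC and (ii) holds then the almost
exchangeable measure is h-NLC. [cite: BorceaBrandenLiggett2007, §6 Prop. 6.3] -/
theorem isHNLC_almostExch {a b : ℕ → ℝ} (ha : IsLogConcaveSeq a) (hb : IsLogConcaveSeq b)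
    (hab : IsLogConcaveSeq fun k => a k + b k) (hii : ∀ k, a (k + 1) * b k ≤ a k * b (k + 1)) :
    IsHNLC (almostExch a b : Finset (Option τ) → ℝ) := by
  intro R
  by_cases hR : none ∈ R
  · rw [projectOn_almostExch_of_mem a b hR]
    have hA := isLogConcaveSeq_binomShift ha Rᶜ.card
    have hB := isLogConcaveSeq_binomShift hb Rᶜ.card
    have hAB : IsLogConcaveSeq fun k => binomShift Rᶜ.card a k + binomShift Rᶜ.card b k := by
      rw [← binomShift_add]; exact isLogConcaveSeq_binomShift hab _
    have hii' := condII_binomShift ha.1 hb.1 hab hii Rᶜ.card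
    exact isNLC_almostExchOn hA hB fun m k l hmk hml => mixed_of_lc hA hB.1 hAB hii' hmk hml
  · rw [projectOn_almostExch_of_not_mem a b hR (binomShift (Rᶜ.erase none).card fun k => a k + b k)]
    have hB := isLogConcaveSeq_binomShift hab (Rᶜ.erase none).card
    exact isNLC_almostExchOn hB hB fun m k l hmk hml => by
      have := hB.mul_le_mul (a := m) (b := k) (c := l) (d := k + l - m) hmk (by omega) (by omega)
      rw [mul_comm, mul_comm (binomShift _ _ l)]
      exact this

/-- A card-profile weight on `τ` that is NLC and vanishes above `n` has an LC profile.
[cite: BorceaBrandenLiggett2007, §6 proof of Prop. 6.3 ("the h-NLC property implies that the sequences in (i)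
have no internal zeros … are LC"); Pemantle2000, §2.4 Thm. 2.7] -/
theorem isLogConcaveSeq_of_isNLC_card {c : ℕ → ℝ} (hc : ∀ k, 0 ≤ c k) (hc0 : ∀ k, Fintype.card τ < k → c k = 0)
    (hN : IsNLC (fun S : Finset τ => c S.card)) : IsLogConcaveSeq c := by
  obtain ⟨q, hq, hcq⟩ := exists_isLogConcaveSeq_of_isNLC (μ := fun S : Finset τ => c S.card) (q := c)
    (fun _ => rfl) (fun S => hc _) hN
  have heq : c = fun k => if k ≤ Fintype.card τ then q k else 0 := by
    funext k
    by_cases hk : k ≤ Fintype.card τ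
    · obtain ⟨S, -, hS⟩ := Finset.exists_subset_card_eq (s := (Finset.univ : Finset τ)) (n := k)
        (by rw [Finset.card_univ]; exact hk)
      rw [if_pos hk, ← hS]
      exact hcq S
    · rw [if_neg hk, hc0 k (not_le.1 hk)]
  rw [heq]
  exact hq.truncLE _

omit [Fintype τ] in
/-- NLC passes from `τ ⊔ {∗}` to the sets avoiding `∗`. [cite: BorceaBrandenLiggett2007, §6 proof of Prop. 6.3
("the pairs `(S,T)`")] -/
theorem IsNLC.comap_some {ν : Finset (Option τ) → ℝ} (h : IsNLC ν) :
    IsNLC fun S : Finset τ => ν (S.map Function.Embedding.some) := by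
  intro S T
  have := h (S.map Function.Embedding.some) (T.map Function.Embedding.some)
  rwa [← Finset.map_union, ← Finset.map_inter] at this

omit [Fintype τ] in
/-- NLC passes to the sets containing `∗`. [cite: BorceaBrandenLiggett2007, §6 proof of Prop. 6.3 ("the pairs
`(S ∪ {n+1}, T ∪ {n+1})`")] -/
theorem IsNLC.comap_insert_none {ν : Finset (Option τ) → ℝ} (h : IsNLC ν) :
    IsNLC fun S : Finset τ => ν (insert none (S.map Function.Embedding.some)) := by
  intro S T
  have := h (insert none (S.map Function.Embedding.some)) (insert none (T.map Function.Embedding.some))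
  rwa [← Finset.insert_union_distrib, ← Finset.insert_inter_distrib, ← Finset.map_union, ← Finset.map_inter] at this

/-- **Borcea–Brändén–Liggett, Prop. 6.3 ("only if")**: for nonnegative profiles vanishing above `n = |τ|`, h-NLC of
the almost exchangeable measure gives (i) `a`, `b`, `a + b` LC and (ii). [cite: BorceaBrandenLiggett2007, §6
Prop. 6.3] -/
theorem BorceaBrandenLiggett_prop_6_3_onlyIf {a b : ℕ → ℝ} (ha : ∀ k, 0 ≤ a k) (hb : ∀ k, 0 ≤ b k)
    (ha0 : ∀ k, Fintype.card τ < k → a k = 0) (hb0 : ∀ k, Fintype.card τ < k → b k = 0)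
    (h : IsHNLC (almostExch a b : Finset (Option τ) → ℝ)) :
    (IsLogConcaveSeq a ∧ IsLogConcaveSeq b ∧ IsLogConcaveSeq fun k => a k + b k) ∧
      ∀ k, a (k + 1) * b k ≤ a k * b (k + 1) := by
  have hN : IsNLC (almostExch a b : Finset (Option τ) → ℝ) := h.isNLC
  have hnone : ∀ S : Finset τ, (none : Option τ) ∉ S.map Function.Embedding.some := fun S h' => by
    obtain ⟨y, _, hy⟩ := Finset.mem_map.1 h'
    exact Option.some_ne_none y hy
  refine ⟨⟨?_, ?_, ?_⟩, fun k => ?_⟩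
  · -- `a`: the sets containing `∗`
    refine isLogConcaveSeq_of_isNLC_card ha ha0 ?_
    have key := hN.comap_insert_none
    have heq : (fun S : Finset τ => almostExch a b (insert none (S.map Function.Embedding.some))) =
        fun S => a S.card := funext fun S => by
      rw [almostExch_apply, if_pos (Finset.mem_insert_self _ _), eraseNone_insert_none, Finset.eraseNone_map_some]
    rwa [heq] at key
  · -- `b`: the sets avoiding `∗`
    refine isLogConcaveSeq_of_isNLC_card hb hb0 ?_
    have key := hN.comap_some
    have heq : (fun S : Finset τ => almostExch a b (S.map Function.Embedding.some)) = fun S => b S.card :=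
      funext fun S => by rw [almostExch_apply, if_neg (hnone S), Finset.eraseNone_map_some]
    rwa [heq] at key
  · -- `a + b`: the projection onto `2^{[n]}`
    refine isLogConcaveSeq_of_isNLC_card (fun k => add_nonneg (ha k) (hb k))
      (fun k hk => by rw [ha0 k hk, hb0 k hk, add_zero]) ?_
    set R : Finset (Option τ) := (Finset.univ : Finset τ).map Function.Embedding.some with hRdef
    have hR : none ∉ R := hnone _
    have hQ : (Rᶜ.erase none).card = 0 := by
      rw [Finset.card_eq_zero, Finset.eq_empty_iff_forall_notMem]
      intro x hx
      rcases Finset.mem_erase.1 hx with ⟨hx1, hx2⟩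
      rcases x with _ | y
      · exact hx1 rfl
      · exact Finset.mem_compl.1 hx2 ((Finset.mem_map' _).2 (Finset.mem_univ y))
    have key := (h R).comap_some
    have hproj := projectOn_almostExch_of_not_mem a b hR (fun k => a k + b k)
    rw [hQ, binomShift_zero] at hproj
    have heq : (fun S : Finset τ => projectOn R (almostExch a b) (S.map Function.Embedding.some)) =
        fun S => a S.card + b S.card := funext fun S => by
      rw [hproj, almostExchOn_apply, if_pos (Finset.map_subset_map.2 (Finset.subset_univ S)), if_neg (hnone S),
        Finset.eraseNone_map_some]
    rwa [heq] at key
  · -- (ii): NLC at `S' ∪ {∗}`, `S' ∪ {p}` for a `k`-subset `S` of `τ ∖ {p}`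
    by_cases hk : k + 1 ≤ Fintype.card τ
    · have hne : Nonempty τ := Fintype.card_pos_iff.1 (by omega)
      obtain ⟨p⟩ := hne
      obtain ⟨S, hSp, hS⟩ := Finset.exists_subset_card_eq (s := (Finset.univ : Finset τ).erase p) (n := k)
        (by rw [Finset.card_erase_of_mem (Finset.mem_univ p), Finset.card_univ]; omega)
      have hpS : p ∉ S := fun h' => (Finset.mem_erase.1 (hSp h')).1 rfl
      set S' : Finset (Option τ) := S.map Function.Embedding.some with hS'
      have hsp : some p ∉ S' := fun h' => hpS ((Finset.mem_map' _).1 h')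
      have key := hN (insert none S') (insert (some p) S')
      have hU : insert none S' ∪ insert (some p) S' = insert none (insert (some p) S') := by
        rw [Finset.insert_union, Finset.union_insert, Finset.union_self]
      have hI : insert none S' ∩ insert (some p) S' = S' := by
        rw [Finset.insert_inter_of_notMem (by rw [Finset.mem_insert, not_or]; exact ⟨(Option.some_ne_none p).symm, hnone S⟩),
          Finset.inter_insert_of_notMem hsp, Finset.inter_self]
      rw [hU, hI, almostExch_apply, almostExch_apply, almostExch_apply, almostExch_apply,
        if_pos (Finset.mem_insert_self _ _), if_neg (hnone S), if_pos (Finset.mem_insert_self _ _),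
        if_neg (by rw [Finset.mem_insert, not_or]; exact ⟨fun h' => Option.some_ne_none p h'.symm, hnone S⟩),
        eraseNone_insert_none, eraseNone_insert_none, hS', Finset.eraseNone_map_some] at key
      have h1 : (insert (some p) (S.map Function.Embedding.some)).eraseNone = insert p S := by
        ext y
        simp [Finset.mem_eraseNone]
      rw [h1, Finset.card_insert_of_notMem hpS, hS] at key
      linarith [key]
    · rw [ha0 (k + 1) (by omega), zero_mul]
      exact mul_nonneg (ha k) (hb _)

/-- **Borcea–Brändén–Liggett, Proposition 6.3.** For nonnegative profiles `a, b` vanishing above `n = |τ|`, the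
almost exchangeable measure `z_{n+1} Σ a_k e_k + Σ b_k e_k` is h-NLC iff (i) `{a_k}`, `{b_k}`, `{a_k + b_k}` are
LC and (ii) `a_k b_{k+1} ≥ a_{k+1} b_k`. [cite: BorceaBrandenLiggett2007, §6 Prop. 6.3] -/
theorem BorceaBrandenLiggett_prop_6_3 {a b : ℕ → ℝ} (ha : ∀ k, 0 ≤ a k) (hb : ∀ k, 0 ≤ b k)
    (ha0 : ∀ k, Fintype.card τ < k → a k = 0) (hb0 : ∀ k, Fintype.card τ < k → b k = 0) :
    IsHNLC (almostExch a b : Finset (Option τ) → ℝ) ↔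
      (IsLogConcaveSeq a ∧ IsLogConcaveSeq b ∧ IsLogConcaveSeq fun k => a k + b k) ∧
        ∀ k, a (k + 1) * b k ≤ a k * b (k + 1) :=
  ⟨BorceaBrandenLiggett_prop_6_3_onlyIf ha hb ha0 hb0, fun h => isHNLC_almostExch h.1.1 h.1.2.1 h.1.2.2 h.2⟩

/-- **Rayleigh ⟹ h-NLC for almost exchangeable measures, at the level of the criteria**: condition (i) of
Prop. 6.2 (all convex combinations LC) contains (i) of Prop. 6.3 (`θ = 1, 0, 1/2`).
[cite: BorceaBrandenLiggett2007, §6 Props. 6.2, 6.3; §2.1 (Rayleigh ⟹ h-NLC)] -/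
theorem condition_i_6_3_of_6_2 {a b : ℕ → ℝ}
    (hi : ∀ θ : ℝ, 0 ≤ θ → θ ≤ 1 → IsLogConcaveSeq fun k => θ * a k + (1 - θ) * b k) :
    IsLogConcaveSeq a ∧ IsLogConcaveSeq b ∧ IsLogConcaveSeq fun k => a k + b k := by
  refine ⟨?_, ?_, ?_⟩
  · have h := hi 1 zero_le_one le_rfl
    have heq : (fun k => (1 : ℝ) * a k + (1 - 1) * b k) = a := funext fun k => by ring
    rwa [heq] at h
  · have h := hi 0 le_rfl zero_le_one
    have heq : (fun k => (0 : ℝ) * a k + (1 - 0) * b k) = b := funext fun k => by ring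
    rwa [heq] at h
  · have h := (hi (1 / 2) (by norm_num) (by norm_num)).const_mul (show (0 : ℝ) ≤ 2 by norm_num)
    have heq : (fun k => (2 : ℝ) * (1 / 2 * a k + (1 - 1 / 2) * b k)) = fun k => a k + b k := funext fun k => by ring
    rwa [heq] at h

end Prop63

end Literature.Probability.NegativeDependence

end
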